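import Literature.AlgebraicGeometry.Resolution.Lipman1969RationalContraction
import Literature.AlgebraicGeometry.Resolution.ExceptionalCurveDegree
import Literature.AlgebraicGeometry.Morphisms.ZariskiConnectednessProper
import HarnessLib

/-!
# The finite-length regime of `h0` (Lipman 1969, §10, p. 212): `h⁰(𝒪_X/𝓘)` is finite for `V(𝓘)`
# proper over a Noetherian local base and supported in the closed fibre

Topic: `Literature/AlgebraicGeometry/Resolution`. PROVED companion (no new definitions, no named facts)
of `Lipman1969RationalContraction`: the `h⁰`-length `h0 π 𝓘 = length_S Γ(X, 𝒪_X/𝓘)` used there is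
FINITE in Lipman's regime — "We will be dealing mainly with curves `C` which admit a proper map
`f : C → Spec(A)` where `A` is a noetherian ring and the image of `f` is zero-dimensional … For such a
`C`, the cohomology modules of any coherent `𝒪_C`-module `ℱ` are of finite length over `A`" (J. Lipman,
Publ. Math. IHÉS 36 (1969), §10, p. 212) — in the case `ℱ = 𝒪_C`, degree `0`, `A = S` local:

* (private helper) `length_ne_top_of_maximalIdeal_locallyNilpotent` — algebra: a finitely generated module over a
  Noetherian local ring `(R, 𝔪)` on which every element of `𝔪` acts locally nilpotently has finite
  length (it is a finitely generated module over the Artinian local ring `R/𝔪^N`).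
* (private helper) `isNilpotent_algebraMap_sections_of_base_eq_closedPoint` — geometry: on a quasi-compact `S`-scheme
  `g : E → Spec S` all of whose points lie over the closed point, every `y ∈ 𝔪` is nilpotent in
  `Γ(E, 𝒪_E)` (its non-vanishing locus `E_y = g⁻¹(D(y))` is empty; Mathlib
  `Scheme.isNilpotent_iff_basicOpen_eq_bot`).
* `h0_ne_top_of_isNilpotent`, `h0_ne_top_of_base_eq_closedPoint` — **`h0 π 𝓘 ≠ ⊤`** for
  `V(𝓘) → Spec S` proper (`S` Noetherian local) with `𝔪` nilpotent on `Γ(V(𝓘), 𝒪)`, in particular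
  when every point of `V(𝓘)` lies over the closed point; the finiteness of `Γ(V(𝓘), 𝒪)` as an
  `S`-module is the tree's THEOREM `Morphisms.moduleFinite_sections_top_of_isProper` (EGA III₁ 3.2.1,
  Stacks 02O5 for `i = 0`, proved in `Morphisms/ZariskiConnectednessProper` by dévissage).
* `h0_pow_primeDivisorIdeal_ne_top` — the case the named facts use: for `π : X → Spec S` proper and
  `η ∈ excCurvePoints π` (an integral exceptional curve `E_η = cl{η}` over the closed point),
  `h0 π (𝓘_η ^ n) ≠ ⊤` for every `n ≥ 1` (`𝓘_η = primeDivisorIdeal η`; `V(𝓘_η^n)` has support `cl{η}`,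
  which lies over the closed point, `ExceptionalCurveDegree.base_eq_closedPoint_of_specializes`).

## References

* J. Lipman, *Rational singularities, with applications to algebraic surfaces and unique
  factorization*, Publ. Math. IHÉS 36 (1969) 195–279, §10 (p. 212). [Lipman1969]
* A. Grothendieck, J. Dieudonné, EGA III₁, Thm. 3.2.1. [EGAIII1]
* The Stacks Project, Tag 02O5. [StacksProject]
-/

noncomputable section

open CategoryTheory AlgebraicGeometry TopologicalSpace IsLocalRing
open Literature.AlgebraicGeometry.Morphisms

universe u

namespace Literature.AlgebraicGeometry.Resolution

/-! ## Algebra: `𝔪` locally nilpotent on a finitely generated module ⇒ finite length -/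

/-- Over a Noetherian local ring `(R, 𝔪)`, a finitely generated module `M` on which every `y ∈ 𝔪`
acts locally nilpotently (`∀ m, ∃ n, yⁿ m = 0`) has FINITE LENGTH: `𝔪` is finitely generated and `M`
has finitely many generators, so `𝔪^N M = 0` for some `N`, and `M` is a finitely generated module over
the Artinian local ring `R/𝔪^N`; the length over `R` equals the length over `R/𝔪^N` (Mathlib
`Module.length_eq_of_surjective`). [folklore] -/
private theorem length_ne_top_of_maximalIdeal_locallyNilpotent {R : Type*} [CommRing R] [IsNoetherianRing R]
    [IsLocalRing R] {M : Type*} [AddCommGroup M] [Module R M] [Module.Finite R M]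
    (h : ∀ y ∈ maximalIdeal R, ∀ m : M, ∃ n : ℕ, y ^ n • m = 0) : Module.length R M ≠ ⊤ := by
  classical
  -- `𝔪 ≤ √(Ann M)`
  have hrad : maximalIdeal R ≤ (Module.annihilator R M).radical := by
    intro y hy
    obtain ⟨T, hT⟩ := Module.Finite.fg_top (R := R) (M := M)
    choose n hn using fun m : M => h y hy m
    refine ⟨T.sup n, Module.mem_annihilator.mpr fun m => ?_⟩
    have hm : m ∈ Submodule.span R (T : Set M) := by rw [hT]; exact Submodule.mem_top
    induction hm using Submodule.span_induction with
    | mem x hx =>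
      have hle : n x ≤ T.sup n := Finset.le_sup hx
      rw [← Nat.sub_add_cancel hle, pow_add, mul_smul, hn x, smul_zero]
    | zero => rw [smul_zero]
    | add x y _ _ hx hy => rw [smul_add, hx, hy, add_zero]
    | smul a x _ hx => rw [smul_comm, hx, smul_zero]
  obtain ⟨N, hN⟩ := Ideal.exists_pow_le_of_le_radical_of_fg hrad (IsNoetherian.noetherian _)
  -- `M` is a module over the Artinian local ring `R ⧸ 𝔪^N`
  set J : Ideal R := maximalIdeal R ^ N with hJ
  by_cases hJtop : J = ⊤
  · -- then `1 ∈ Ann M`, `M = 0`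
    have h1 : (1 : R) ∈ Module.annihilator R M := hN (hJtop ▸ Submodule.mem_top)
    haveI : Subsingleton M := ⟨fun a b => by
      have ha := Module.mem_annihilator.mp h1 a
      have hb := Module.mem_annihilator.mp h1 b
      rw [one_smul] at ha hb
      rw [ha, hb]⟩
    rw [Module.length_eq_zero]
    exact ENat.zero_ne_top
  have htors : Module.IsTorsionBySet R M (J : Set R) :=
    (Module.isTorsionBySet_iff_subset_annihilator R M).mpr hN
  letI : Module (R ⧸ J) M := htors.module
  haveI : IsScalarTower R (R ⧸ J) M := htors.isScalarTower
  haveI : Nontrivial (R ⧸ J) := Ideal.Quotient.nontrivial_iff.mpr hJtop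
  haveI : IsLocalRing (R ⧸ J) :=
    IsLocalRing.of_surjective' (Ideal.Quotient.mk J) Ideal.Quotient.mk_surjective
  haveI : IsArtinianRing (R ⧸ J) := by
    rw [isArtinianRing_iff_isNilpotent_maximalIdeal]
    refine ⟨N, ?_⟩
    rw [← IsLocalRing.map_maximalIdeal_of_surjective (Ideal.Quotient.mk J) Ideal.Quotient.mk_surjective,
      ← Ideal.map_pow, Ideal.zero_eq_bot, hJ, Ideal.map_quotient_self]
  haveI : Module.Finite (R ⧸ J) M := Module.Finite.of_restrictScalars_finite R (R ⧸ J) M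
  have hsurj : Function.Surjective (algebraMap R (R ⧸ J)) := by
    rw [Ideal.Quotient.algebraMap_eq]; exact Ideal.Quotient.mk_surjective
  rw [Module.length_eq_of_surjective (S := R) (R := R ⧸ J) hsurj]
  exact Module.length_ne_top

/-! ## Geometry: over the closed point, `𝔪` is nilpotent in the global sections -/

section ClosedFibre

variable {S : Type u} [CommRing S] [IsLocalRing S] {E : Scheme.{u}} (g : E ⟶ Spec (.of S))

/-- **`𝔪` is nilpotent on a scheme lying over the closed point**: if `g : E → Spec S` (`S` local,
`E` quasi-compact) maps every point of `E` to the closed point, then for `y ∈ 𝔪` the global section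
`y·1 ∈ Γ(E, 𝒪_E)` (the structure map `S → Γ(E, 𝒪_E)` of `Morphisms.Sections g ⊤`) is nilpotent: its
non-vanishing locus `E_y = g⁻¹(D(y))` (Mathlib `Scheme.preimage_basicOpen_top`, `basicOpen_eq_of_affine`)
is empty since `y ∈ 𝔪 = g(x)` for all `x`, and a global section of a quasi-compact scheme with empty
non-vanishing locus is nilpotent (`Scheme.isNilpotent_iff_basicOpen_eq_bot`). [folklore] -/
private theorem isNilpotent_algebraMap_sections_of_base_eq_closedPoint [CompactSpace E]
    (hfib : ∀ x : E, g.base x = closedPoint S) {y : S} (hy : y ∈ maximalIdeal S) :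
    IsNilpotent (algebraMap S (Sections g ⊤) y) := by
  have h1 : algebraMap S (Sections g ⊤) y = g.appTop ((Scheme.ΓSpecIso (.of S)).inv y) := by
    rw [Sections.algebraMap_apply]
    have : (homOfLE (le_top : (⊤ : E.Opens) ≤ ⊤)).op = 𝟙 _ := Subsingleton.elim _ _
    rw [this, E.presheaf.map_id]
    rfl
  rw [h1]
  change IsNilpotent (g.appTop ((Scheme.ΓSpecIso (.of S)).inv y) : Γ(E, ⊤))
  rw [Scheme.isNilpotent_iff_basicOpen_eq_bot, ← Scheme.preimage_basicOpen_top,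
    basicOpen_eq_of_affine]
  ext x
  simp only [Opens.coe_bot, Set.mem_empty_iff_false, iff_false]
  intro hx
  have hx' : g.base x ∈ PrimeSpectrum.basicOpen y := hx
  rw [hfib x] at hx'
  exact ((PrimeSpectrum.mem_basicOpen ..).mp hx') hy

end ClosedFibre

/-! ## The regime of `h0` -/

section Regime

variable {S : Type u} [CommRing S] [IsNoetherianRing S] [IsLocalRing S] {X : Scheme.{u}}

/-- **`h0 π 𝓘` is finite when `V(𝓘)` is proper over the Noetherian local `S` and `𝔪` is nilpotent in
`Γ(V(𝓘), 𝒪)`**: `Γ(V(𝓘), 𝒪)` is a finite `S`-module (the tree's `moduleFinite_sections_top_of_isProper`,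
EGA III₁ 3.2.1 for `i = 0`) on which `𝔪` acts locally nilpotently, hence of finite length
(`length_ne_top_of_maximalIdeal_locallyNilpotent`). This is Lipman's standing remark of §10 (p. 212,
"the cohomology modules of any coherent `𝒪_C`-module `ℱ` are of finite length over `A`") for
`ℱ = 𝒪_C`, `C = V(𝓘)`, degree `0`. [cite: Lipman1969, Section 10 (p. 212)] -/
theorem h0_ne_top_of_isNilpotent (π : X ⟶ Spec (.of S)) (𝓘 : X.IdealSheafData)
    [IsProper (𝓘.subschemeι ≫ π)]
    (h : ∀ y ∈ maximalIdeal S, IsNilpotent (algebraMap S (Sections (𝓘.subschemeι ≫ π) ⊤) y)) :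
    h0 π 𝓘 ≠ ⊤ := by
  haveI : Module.Finite S (Sections (𝓘.subschemeι ≫ π) ⊤) :=
    moduleFinite_sections_top_of_isProper _
  refine length_ne_top_of_maximalIdeal_locallyNilpotent fun y hy m => ?_
  obtain ⟨n, hn⟩ := h y hy
  exact ⟨n, by rw [Algebra.smul_def, map_pow, hn, zero_mul]⟩

/-- **`h0 π 𝓘` is finite when `V(𝓘)` is proper over the Noetherian local `S` and lies over the closed
point** (Lipman §10, p. 212: a curve proper over `Spec A` "with zero-dimensional image" has cohomology
of finite length over `A`; here degree `0`, any dimension): combine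
`isNilpotent_algebraMap_sections_of_base_eq_closedPoint` and `h0_ne_top_of_isNilpotent`.
[cite: Lipman1969, Section 10 (p. 212)] -/
theorem h0_ne_top_of_base_eq_closedPoint (π : X ⟶ Spec (.of S)) (𝓘 : X.IdealSheafData)
    [IsProper (𝓘.subschemeι ≫ π)]
    (hfib : ∀ x : 𝓘.subscheme, (𝓘.subschemeι ≫ π).base x = closedPoint S) : h0 π 𝓘 ≠ ⊤ := by
  haveI : CompactSpace 𝓘.subscheme :=
    QuasiCompact.compactSpace_of_compactSpace (𝓘.subschemeι ≫ π)
  exact h0_ne_top_of_isNilpotent π 𝓘 fun y hy =>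
    isNilpotent_algebraMap_sections_of_base_eq_closedPoint _ hfib hy

/-- **Finiteness of `h⁰(𝒪_{nE})` for an integral exceptional curve `E = E_η`** over a Noetherian local
base: for `π : X → Spec S` proper and `η ∈ excCurvePoints π` (a point over the closed point with
one-dimensional closure), `h0 π (𝓘_η ^ n) ≠ ⊤` for all `n ≥ 1`, `𝓘_η = primeDivisorIdeal η` — the
closed subscheme `V(𝓘_η^n)` is proper over `S` (a closed subscheme of the proper `X`) with support
`cl{η}` (`support_pow`, `coe_support_primeDivisorIdeal`), all of whose points specialise from `η` and
hence lie over the closed point (`base_eq_closedPoint_of_specializes`). In particular the numbers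
`h0 π 𝓘_η`, `h0 π (𝓘_η ^ 2)` of `Lipman1969_27_3_rat` / `Lipman1969_27_1_reg_rat` are finite (Lipman
§10, p. 212). [cite: Lipman1969, Section 10 (p. 212)] -/
theorem h0_pow_primeDivisorIdeal_ne_top (π : X ⟶ Spec (.of S)) [IsProper π] {η : X}
    (hη : η ∈ excCurvePoints π) {n : ℕ} (hn : n ≠ 0) :
    h0 π (primeDivisorIdeal η ^ n) ≠ ⊤ := by
  set 𝓘 : X.IdealSheafData := primeDivisorIdeal η ^ n with h𝓘
  haveI : IsProper (𝓘.subschemeι ≫ π) := inferInstance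
  refine h0_ne_top_of_base_eq_closedPoint π 𝓘 fun x => ?_
  -- the point `𝓘.subschemeι x` lies in the support `cl{η}` of `𝓘_η^n`
  have hx : 𝓘.subschemeι.base x ∈ closure ({η} : Set X) := by
    have hmem : 𝓘.subschemeι.base x ∈ (𝓘.support : Set X) :=
      (Set.ext_iff.mp (Scheme.IdealSheafData.range_subschemeι (I := 𝓘)) _).mp
        (Set.mem_range_self x)
    have hsupp : (𝓘.support : Set X) = closure {η} := by
      rw [h𝓘, Scheme.IdealSheafData.support_pow _ n hn, coe_support_primeDivisorIdeal]
    rwa [hsupp] at hmem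
  have hspec : η ⤳ 𝓘.subschemeι.base x := specializes_iff_mem_closure.mpr hx
  change π.base (𝓘.subschemeι.base x) = closedPoint S
  exact base_eq_closedPoint_of_specializes π hη.1 hspec

end Regime

end Literature.AlgebraicGeometry.Resolution

end
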